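import Summits.CriticalPhenomena.PercolationContinuityZ3.Theorems.Transplant.FKConnectivityAllQAntipodalTwoSpineDefs
import HarnessLib

/-!
# Connectivity correlation inequalities for `φ_{w,q}` — TWO-SPINE word model: admissible families are MONOTONE ALONG FLIP CHAINS

Helper file (`--supports stmt-CriticalPhenomena-4575`), FK sub-lane `prim-bschramm-fk-2` (gen 15); builds on p205010 (kernel theorem,
internal audit signed; external expert review pending).  No named facts, no sorries, standard axioms.

Memo `bschramm/FROM-fk-2-g15-TWO-SPINE.md` §10.9 / blueprint L2.4: every move of the two-spine rule raises both words letterwise (`01 → 10`,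
the `Forall₂` flip relation of `phiRun_forall₂` / `sigma_wordHall`), so the admissible test family does not decrease along it
(`Admissible.le_of_forall₂`; `Admissible.monoA/monoB` are the one-letter flips = Theorem U per part, gen 14 `fiberSum_le_of_flip`).
This is the inequality `S(target) ≥ S(source)` summed by the certificate.
[cite: Grimmett2006, §3.9 (p. 63)]
-/

namespace Summit.CriticalPhenomena.PercolationContinuityZ3.Theorems

namespace FK

namespace TwoSpine

open X2Word

/-! ### Admissible families are monotone along chains of `01 → 10` flips -/

/-- An admissible family is monotone in the `A`-word along the letterwise flip relation (any number of `01 → 10` flips), with an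
arbitrary common prefix. [folklore] -/
theorem Admissible.monoA_forall₂_prefix {D : Diagram} {S : ℕ → List SLetter → List SLetter → ℝ} (hS : Admissible D S) (i : ℕ)
    (v : List SLetter) :
    ∀ (pre u u' : List SLetter),
      List.Forall₂ (fun a b : SLetter => b = a ∨ (a.2 = (false, true) ∧ b = (a.1, true, false))) u u' →
        S i (pre ++ u) v ≤ S i (pre ++ u') v := by
  intro pre u u' h
  induction h generalizing pre with
  | nil => exact le_refl _
  | @cons a b u u' hab _ ih =>
    have step1 : S i (pre ++ a :: u) v ≤ S i (pre ++ a :: u') v := by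
      have := ih (pre ++ [a]); simpa using this
    refine le_trans step1 ?_
    rcases hab with rfl | ⟨ha, rfl⟩
    · exact le_refl _
    · obtain ⟨k, bits⟩ := a
      simp only at ha
      subst ha
      exact hS.monoA i (pre ++ (k, false, true) :: u') (pre ++ (k, true, false) :: u') v ⟨pre, u', k, rfl, rfl⟩

/-- **Monotonicity in the `A`-word** along the flip relation. [folklore] -/
theorem Admissible.monoA_forall₂ {D : Diagram} {S : ℕ → List SLetter → List SLetter → ℝ} (hS : Admissible D S) (i : ℕ)
    {u u' : List SLetter} (v : List SLetter)
    (h : List.Forall₂ (fun a b : SLetter => b = a ∨ (a.2 = (false, true) ∧ b = (a.1, true, false))) u u') :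
    S i u v ≤ S i u' v := by
  simpa using hS.monoA_forall₂_prefix i v [] u u' h

/-- The same in the `B`-word. [folklore] -/
theorem Admissible.monoB_forall₂_prefix {D : Diagram} {S : ℕ → List SLetter → List SLetter → ℝ} (hS : Admissible D S) (i : ℕ)
    (u : List SLetter) :
    ∀ (pre v v' : List SLetter),
      List.Forall₂ (fun a b : SLetter => b = a ∨ (a.2 = (false, true) ∧ b = (a.1, true, false))) v v' →
        S i u (pre ++ v) ≤ S i u (pre ++ v') := by
  intro pre v v' h
  induction h generalizing pre with
  | nil => exact le_refl _
  | @cons a b v v' hab _ ih =>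
    have step1 : S i u (pre ++ a :: v) ≤ S i u (pre ++ a :: v') := by
      have := ih (pre ++ [a]); simpa using this
    refine le_trans step1 ?_
    rcases hab with rfl | ⟨ha, rfl⟩
    · exact le_refl _
    · obtain ⟨k, bits⟩ := a
      simp only at ha
      subst ha
      exact hS.monoB i u (pre ++ (k, false, true) :: v') (pre ++ (k, true, false) :: v') ⟨pre, v', k, rfl, rfl⟩

/-- **Monotonicity in the `B`-word** along the flip relation. [folklore] -/
theorem Admissible.monoB_forall₂ {D : Diagram} {S : ℕ → List SLetter → List SLetter → ℝ} (hS : Admissible D S) (i : ℕ)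
    (u : List SLetter) {v v' : List SLetter}
    (h : List.Forall₂ (fun a b : SLetter => b = a ∨ (a.2 = (false, true) ∧ b = (a.1, true, false))) v v') :
    S i u v ≤ S i u v' := by
  simpa using hS.monoB_forall₂_prefix i u [] v v' h

/-- **A rule move raises the test function**: if both words only go up, `S` does not decrease (the Janus is invisible to `S`). [folklore] -/
theorem Admissible.le_of_forall₂ {D : Diagram} {S : ℕ → List SLetter → List SLetter → ℝ} (hS : Admissible D S) (i : ℕ)
    {u u' v v' : List SLetter}
    (hu : List.Forall₂ (fun a b : SLetter => b = a ∨ (a.2 = (false, true) ∧ b = (a.1, true, false))) u u')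
    (hv : List.Forall₂ (fun a b : SLetter => b = a ∨ (a.2 = (false, true) ∧ b = (a.1, true, false))) v v') :
    S i u v ≤ S i u' v' :=
  le_trans (hS.monoA_forall₂ i v hu) (hS.monoB_forall₂ i u' hv)

end TwoSpine

end FK

end Summit.CriticalPhenomena.PercolationContinuityZ3.Theorems
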